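import Summits.ValiantsHypothesis.ValiantsHypothesis.Theorems.KPlusLogSqLawTropicalBFourFourOrderTypeLawA44RT0
import Summits.ValiantsHypothesis.ValiantsHypothesis.Theorems.KPlusLogSqLawTropicalBFourFourOrderTypeLawA44RT1
import Summits.ValiantsHypothesis.ValiantsHypothesis.Theorems.KPlusLogSqLawTropicalBFourFourOrderTypeLawA44RT2
import Summits.ValiantsHypothesis.ValiantsHypothesis.Theorems.KPlusLogSqLawTropicalBFourFourOrderTypeLawA44RT3
import Summits.ValiantsHypothesis.ValiantsHypothesis.Theorems.KPlusLogSqLawTropicalBFourFourOrderTypeLawA44RT4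
import Summits.ValiantsHypothesis.ValiantsHypothesis.Theorems.KPlusLogSqLawTropicalBFourFourOrderTypeLawA44RT5
import Summits.ValiantsHypothesis.ValiantsHypothesis.Theorems.KPlusLogSqLawTropicalBFourFourOrderTypeLawA44RT6
import Summits.ValiantsHypothesis.ValiantsHypothesis.Theorems.KPlusLogSqLawTropicalBFourFourOrderTypeLawA44RT7
import Summits.ValiantsHypothesis.ValiantsHypothesis.Theorems.KPlusLogSqLawTropicalBFourFourOrderTypeLawA44RT8
import Summits.ValiantsHypothesis.ValiantsHypothesis.Theorems.KPlusLogSqLawTropicalBFourFourOrderTypeLawA44RT9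
import Summits.ValiantsHypothesis.ValiantsHypothesis.Theorems.KPlusLogSqLawTropicalBFourFourOrderTypeLawA44RT10
import Summits.ValiantsHypothesis.ValiantsHypothesis.Theorems.KPlusLogSqLawTropicalBFourFourOrderTypeLawA44RT11
import Summits.ValiantsHypothesis.ValiantsHypothesis.Theorems.KPlusLogSqLawTropicalBFourFourOrderTypeLawA44RT12
import Summits.ValiantsHypothesis.ValiantsHypothesis.Theorems.KPlusLogSqLawTropicalBFourFourOrderTypeLawA44RT13
import Summits.ValiantsHypothesis.ValiantsHypothesis.Theorems.KPlusLogSqLawTropicalBFourFourOrderTypeLawA44RT14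
import Summits.ValiantsHypothesis.ValiantsHypothesis.Theorems.KPlusLogSqLawTropicalBFourFourOrderTypeLawA44RT15
import Summits.ValiantsHypothesis.ValiantsHypothesis.Theorems.KPlusLogSqLawTropicalBFourFourOrderTypeLawA44RT16
import Summits.ValiantsHypothesis.ValiantsHypothesis.Theorems.KPlusLogSqLawTropicalBFourFourOrderTypeLawA44RT17
import Summits.ValiantsHypothesis.ValiantsHypothesis.Theorems.KPlusLogSqLawTropicalBFourFourOrderTypeLawA44RT18
import Summits.ValiantsHypothesis.ValiantsHypothesis.Theorems.KPlusLogSqLawTropicalBFourFourOrderTypeLawA44RT19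
import Summits.ValiantsHypothesis.ValiantsHypothesis.Theorems.KPlusLogSqLawTropicalBFourFourOrderTypeLawA44RT20
import Summits.ValiantsHypothesis.ValiantsHypothesis.Theorems.KPlusLogSqLawTropicalBFourFourOrderTypeLawA44RT21
import Summits.ValiantsHypothesis.ValiantsHypothesis.Theorems.KPlusLogSqLawTropicalBFourFourOrderTypeLawA44RT22
import Summits.ValiantsHypothesis.ValiantsHypothesis.Theorems.KPlusLogSqLawTropicalBFourFourOrderTypeLawA44RT23

/-!
# Route «KPlusLogSqLaw», crux `TropicalB` (stmt-ValiantsHypothesis-19771) — `(4,4)` ORDER-TYPE LAW A44R (assembly):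
# on the order-type cell of `(0,12,17,25)` the `(4,4)` cell is NOT counting-tight — `T(4,4; d) ≤ 33 < 34 = T(4,4)`

HONEST FRAMING.  Census-structure helper toward the crux `Summit.ValiantsHypothesis.ValiantsHypothesis.Theses.KPlusLogSqLaw.TropicalB` (item
`stmt-ValiantsHypothesis-19771`, route `KPlusLogSqLaw`; cell `pub-symmetroid`, seat val-sym-trop-p5 g12, 2026-08-28; `--supports … --as helper`).  A
finite statement about `4 × 4` designs with four slope classes; nothing here bears on `TropicalB` in its window, `WeakLifting`, the doors,
`MatrixDescartes` (stmt-ValiantsHypothesis-18050) or VP ≠ VNP.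

THE LAW (`designRowD_four_four_33_A44R`).  For every `d : Fin 4 → ℕ` with `d 0 + 2 * d 2 ≤ 3 * d 1`, `d 0 + 2 * d 3 ≤ 3 * d 2`, `2 * d 1 ≤ d 0 + d 3` and the strict slope
order `4 * d 0 < 4 * d 1`, `4 * d 1 < 2 * d 0 + 2 * d 3`, `d 0 + 2 * d 3 < 3 * d 2` (the closed order-type cell of `(0,12,17,25)`, at the triple point `4e₁ = 3e₂ = 2e₃`, `e = d − d₀`),
every chain of unique optima of a `(4,4)` design with exponents `d` at strictly increasing integer slopes with distinct consecutive terms has `n ≤ 33` —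
one below the slope count `C(7,3) − 1 = 34 = T(4,4)` (`census_four_four_tight_bound`, exponents `(0,6,15,19)`).  So the `K = 4` census value is an
order-type invariant at `m = 4` as at `m = 3` (`…ThreeFourOrderTypeLaw*`): the first exponent region where the `(4,4)` cell is deficient.  MECHANISM:
the core `4000 ≺ 0400 ≺ 2002 ≺ 1030` (all-0 anchor, all-class-1 term, «one 0 + three 2», «two 0 + two 3» — the `m = 4` analogue of the `(3,4)` core at
`3e₁ = 2e₂ = e₃`) is refuted in 24 branches (`…A44RT*`, one `decide +kernel` each; 3696 region-uniform Farkas certificates in total,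
exact rational LP with prefix constraints at the cell's three extreme rays), assembled with `refute_mono` / `refute_cons_of_forall` / `refute1_of_refute`.
[this cell]
-/

set_option linter.dupNamespace false
set_option autoImplicit false

namespace Summit.ValiantsHypothesis.ValiantsHypothesis.Theorems.KPlusLogSqLaw

namespace FourFourCore

open ThreeFourCore (form comb form_comb form_sub form_ite)
open Summit.ValiantsHypothesis.ValiantsHypothesis.Theorems.MatrixDescartes.Negative
open Summit.ValiantsHypothesis.ValiantsHypothesis.Theorems.LacunarySymmetroidMatrixDescartes.TropicalCensus
open Finset

/-- the union of the branch tables (right-nested). -/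
def tab_A44R : List Cert := tab_A44R_0 ++ (tab_A44R_1 ++ (tab_A44R_2 ++ (tab_A44R_3 ++ (tab_A44R_4 ++ (tab_A44R_5 ++ (tab_A44R_6 ++ (tab_A44R_7 ++ (tab_A44R_8 ++ (tab_A44R_9 ++ (tab_A44R_10 ++ (tab_A44R_11 ++ (tab_A44R_12 ++ (tab_A44R_13 ++ (tab_A44R_14 ++ (tab_A44R_15 ++ (tab_A44R_16 ++ (tab_A44R_17 ++ (tab_A44R_18 ++ (tab_A44R_19 ++ (tab_A44R_20 ++ (tab_A44R_21 ++ (tab_A44R_22 ++ (tab_A44R_23)))))))))))))))))))))))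

/-- branch 0 lifted to the union table. -/
theorem rb_A44R_0 : refute Gneg_A44R G_A44R tab_A44R [anchor_A44R, (![0, 1, 2, 3], ![1, 1, 1, 1])] rest_A44R = true :=
  refute_mono Gneg_A44R G_A44R tab_A44R_0 tab_A44R (fun pre h => by unfold tab_A44R; exact certFor_append G_A44R _ _ pre h) _ _ refuted_A44R_0

/-- branch 1 lifted to the union table. -/
theorem rb_A44R_1 : refute Gneg_A44R G_A44R tab_A44R [anchor_A44R, (![0, 1, 3, 2], ![1, 1, 1, 1])] rest_A44R = true :=
  refute_mono Gneg_A44R G_A44R tab_A44R_1 tab_A44R (fun pre h => by unfold tab_A44R; exact certFor_append_left G_A44R _ _ pre (certFor_append G_A44R _ _ pre h)) _ _ refuted_A44R_1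

/-- branch 2 lifted to the union table. -/
theorem rb_A44R_2 : refute Gneg_A44R G_A44R tab_A44R [anchor_A44R, (![0, 2, 1, 3], ![1, 1, 1, 1])] rest_A44R = true :=
  refute_mono Gneg_A44R G_A44R tab_A44R_2 tab_A44R (fun pre h => by unfold tab_A44R; exact certFor_append_left G_A44R _ _ pre (certFor_append_left G_A44R _ _ pre (certFor_append G_A44R _ _ pre h))) _ _ refuted_A44R_2

/-- branch 3 lifted to the union table. -/
theorem rb_A44R_3 : refute Gneg_A44R G_A44R tab_A44R [anchor_A44R, (![0, 2, 3, 1], ![1, 1, 1, 1])] rest_A44R = true :=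
  refute_mono Gneg_A44R G_A44R tab_A44R_3 tab_A44R (fun pre h => by unfold tab_A44R; exact certFor_append_left G_A44R _ _ pre (certFor_append_left G_A44R _ _ pre (certFor_append_left G_A44R _ _ pre (certFor_append G_A44R _ _ pre h)))) _ _ refuted_A44R_3

/-- branch 4 lifted to the union table. -/
theorem rb_A44R_4 : refute Gneg_A44R G_A44R tab_A44R [anchor_A44R, (![0, 3, 1, 2], ![1, 1, 1, 1])] rest_A44R = true :=
  refute_mono Gneg_A44R G_A44R tab_A44R_4 tab_A44R (fun pre h => by unfold tab_A44R; exact certFor_append_left G_A44R _ _ pre (certFor_append_left G_A44R _ _ pre (certFor_append_left G_A44R _ _ pre (certFor_append_left G_A44R _ _ pre (certFor_append G_A44R _ _ pre h))))) _ _ refuted_A44R_4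

/-- branch 5 lifted to the union table. -/
theorem rb_A44R_5 : refute Gneg_A44R G_A44R tab_A44R [anchor_A44R, (![0, 3, 2, 1], ![1, 1, 1, 1])] rest_A44R = true :=
  refute_mono Gneg_A44R G_A44R tab_A44R_5 tab_A44R (fun pre h => by unfold tab_A44R; exact certFor_append_left G_A44R _ _ pre (certFor_append_left G_A44R _ _ pre (certFor_append_left G_A44R _ _ pre (certFor_append_left G_A44R _ _ pre (certFor_append_left G_A44R _ _ pre (certFor_append G_A44R _ _ pre h)))))) _ _ refuted_A44R_5

/-- branch 6 lifted to the union table. -/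
theorem rb_A44R_6 : refute Gneg_A44R G_A44R tab_A44R [anchor_A44R, (![1, 0, 2, 3], ![1, 1, 1, 1])] rest_A44R = true :=
  refute_mono Gneg_A44R G_A44R tab_A44R_6 tab_A44R (fun pre h => by unfold tab_A44R; exact certFor_append_left G_A44R _ _ pre (certFor_append_left G_A44R _ _ pre (certFor_append_left G_A44R _ _ pre (certFor_append_left G_A44R _ _ pre (certFor_append_left G_A44R _ _ pre (certFor_append_left G_A44R _ _ pre (certFor_append G_A44R _ _ pre h))))))) _ _ refuted_A44R_6

/-- branch 7 lifted to the union table. -/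
theorem rb_A44R_7 : refute Gneg_A44R G_A44R tab_A44R [anchor_A44R, (![1, 0, 3, 2], ![1, 1, 1, 1])] rest_A44R = true :=
  refute_mono Gneg_A44R G_A44R tab_A44R_7 tab_A44R (fun pre h => by unfold tab_A44R; exact certFor_append_left G_A44R _ _ pre (certFor_append_left G_A44R _ _ pre (certFor_append_left G_A44R _ _ pre (certFor_append_left G_A44R _ _ pre (certFor_append_left G_A44R _ _ pre (certFor_append_left G_A44R _ _ pre (certFor_append_left G_A44R _ _ pre (certFor_append G_A44R _ _ pre h)))))))) _ _ refuted_A44R_7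

/-- branch 8 lifted to the union table. -/
theorem rb_A44R_8 : refute Gneg_A44R G_A44R tab_A44R [anchor_A44R, (![1, 2, 0, 3], ![1, 1, 1, 1])] rest_A44R = true :=
  refute_mono Gneg_A44R G_A44R tab_A44R_8 tab_A44R (fun pre h => by unfold tab_A44R; exact certFor_append_left G_A44R _ _ pre (certFor_append_left G_A44R _ _ pre (certFor_append_left G_A44R _ _ pre (certFor_append_left G_A44R _ _ pre (certFor_append_left G_A44R _ _ pre (certFor_append_left G_A44R _ _ pre (certFor_append_left G_A44R _ _ pre (certFor_append_left G_A44R _ _ pre (certFor_append G_A44R _ _ pre h))))))))) _ _ refuted_A44R_8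

/-- branch 9 lifted to the union table. -/
theorem rb_A44R_9 : refute Gneg_A44R G_A44R tab_A44R [anchor_A44R, (![1, 2, 3, 0], ![1, 1, 1, 1])] rest_A44R = true :=
  refute_mono Gneg_A44R G_A44R tab_A44R_9 tab_A44R (fun pre h => by unfold tab_A44R; exact certFor_append_left G_A44R _ _ pre (certFor_append_left G_A44R _ _ pre (certFor_append_left G_A44R _ _ pre (certFor_append_left G_A44R _ _ pre (certFor_append_left G_A44R _ _ pre (certFor_append_left G_A44R _ _ pre (certFor_append_left G_A44R _ _ pre (certFor_append_left G_A44R _ _ pre (certFor_append_left G_A44R _ _ pre (certFor_append G_A44R _ _ pre h)))))))))) _ _ refuted_A44R_9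

/-- branch 10 lifted to the union table. -/
theorem rb_A44R_10 : refute Gneg_A44R G_A44R tab_A44R [anchor_A44R, (![1, 3, 0, 2], ![1, 1, 1, 1])] rest_A44R = true :=
  refute_mono Gneg_A44R G_A44R tab_A44R_10 tab_A44R (fun pre h => by unfold tab_A44R; exact certFor_append_left G_A44R _ _ pre (certFor_append_left G_A44R _ _ pre (certFor_append_left G_A44R _ _ pre (certFor_append_left G_A44R _ _ pre (certFor_append_left G_A44R _ _ pre (certFor_append_left G_A44R _ _ pre (certFor_append_left G_A44R _ _ pre (certFor_append_left G_A44R _ _ pre (certFor_append_left G_A44R _ _ pre (certFor_append_left G_A44R _ _ pre (certFor_append G_A44R _ _ pre h))))))))))) _ _ refuted_A44R_10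

/-- branch 11 lifted to the union table. -/
theorem rb_A44R_11 : refute Gneg_A44R G_A44R tab_A44R [anchor_A44R, (![1, 3, 2, 0], ![1, 1, 1, 1])] rest_A44R = true :=
  refute_mono Gneg_A44R G_A44R tab_A44R_11 tab_A44R (fun pre h => by unfold tab_A44R; exact certFor_append_left G_A44R _ _ pre (certFor_append_left G_A44R _ _ pre (certFor_append_left G_A44R _ _ pre (certFor_append_left G_A44R _ _ pre (certFor_append_left G_A44R _ _ pre (certFor_append_left G_A44R _ _ pre (certFor_append_left G_A44R _ _ pre (certFor_append_left G_A44R _ _ pre (certFor_append_left G_A44R _ _ pre (certFor_append_left G_A44R _ _ pre (certFor_append_left G_A44R _ _ pre (certFor_append G_A44R _ _ pre h)))))))))))) _ _ refuted_A44R_11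

/-- branch 12 lifted to the union table. -/
theorem rb_A44R_12 : refute Gneg_A44R G_A44R tab_A44R [anchor_A44R, (![2, 0, 1, 3], ![1, 1, 1, 1])] rest_A44R = true :=
  refute_mono Gneg_A44R G_A44R tab_A44R_12 tab_A44R (fun pre h => by unfold tab_A44R; exact certFor_append_left G_A44R _ _ pre (certFor_append_left G_A44R _ _ pre (certFor_append_left G_A44R _ _ pre (certFor_append_left G_A44R _ _ pre (certFor_append_left G_A44R _ _ pre (certFor_append_left G_A44R _ _ pre (certFor_append_left G_A44R _ _ pre (certFor_append_left G_A44R _ _ pre (certFor_append_left G_A44R _ _ pre (certFor_append_left G_A44R _ _ pre (certFor_append_left G_A44R _ _ pre (certFor_append_left G_A44R _ _ pre (certFor_append G_A44R _ _ pre h))))))))))))) _ _ refuted_A44R_12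

/-- branch 13 lifted to the union table. -/
theorem rb_A44R_13 : refute Gneg_A44R G_A44R tab_A44R [anchor_A44R, (![2, 0, 3, 1], ![1, 1, 1, 1])] rest_A44R = true :=
  refute_mono Gneg_A44R G_A44R tab_A44R_13 tab_A44R (fun pre h => by unfold tab_A44R; exact certFor_append_left G_A44R _ _ pre (certFor_append_left G_A44R _ _ pre (certFor_append_left G_A44R _ _ pre (certFor_append_left G_A44R _ _ pre (certFor_append_left G_A44R _ _ pre (certFor_append_left G_A44R _ _ pre (certFor_append_left G_A44R _ _ pre (certFor_append_left G_A44R _ _ pre (certFor_append_left G_A44R _ _ pre (certFor_append_left G_A44R _ _ pre (certFor_append_left G_A44R _ _ pre (certFor_append_left G_A44R _ _ pre (certFor_append_left G_A44R _ _ pre (certFor_append G_A44R _ _ pre h)))))))))))))) _ _ refuted_A44R_13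

/-- branch 14 lifted to the union table. -/
theorem rb_A44R_14 : refute Gneg_A44R G_A44R tab_A44R [anchor_A44R, (![2, 1, 0, 3], ![1, 1, 1, 1])] rest_A44R = true :=
  refute_mono Gneg_A44R G_A44R tab_A44R_14 tab_A44R (fun pre h => by unfold tab_A44R; exact certFor_append_left G_A44R _ _ pre (certFor_append_left G_A44R _ _ pre (certFor_append_left G_A44R _ _ pre (certFor_append_left G_A44R _ _ pre (certFor_append_left G_A44R _ _ pre (certFor_append_left G_A44R _ _ pre (certFor_append_left G_A44R _ _ pre (certFor_append_left G_A44R _ _ pre (certFor_append_left G_A44R _ _ pre (certFor_append_left G_A44R _ _ pre (certFor_append_left G_A44R _ _ pre (certFor_append_left G_A44R _ _ pre (certFor_append_left G_A44R _ _ pre (certFor_append_left G_A44R _ _ pre (certFor_append G_A44R _ _ pre h))))))))))))))) _ _ refuted_A44R_14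

/-- branch 15 lifted to the union table. -/
theorem rb_A44R_15 : refute Gneg_A44R G_A44R tab_A44R [anchor_A44R, (![2, 1, 3, 0], ![1, 1, 1, 1])] rest_A44R = true :=
  refute_mono Gneg_A44R G_A44R tab_A44R_15 tab_A44R (fun pre h => by unfold tab_A44R; exact certFor_append_left G_A44R _ _ pre (certFor_append_left G_A44R _ _ pre (certFor_append_left G_A44R _ _ pre (certFor_append_left G_A44R _ _ pre (certFor_append_left G_A44R _ _ pre (certFor_append_left G_A44R _ _ pre (certFor_append_left G_A44R _ _ pre (certFor_append_left G_A44R _ _ pre (certFor_append_left G_A44R _ _ pre (certFor_append_left G_A44R _ _ pre (certFor_append_left G_A44R _ _ pre (certFor_append_left G_A44R _ _ pre (certFor_append_left G_A44R _ _ pre (certFor_append_left G_A44R _ _ pre (certFor_append_left G_A44R _ _ pre (certFor_append G_A44R _ _ pre h)))))))))))))))) _ _ refuted_A44R_15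

/-- branch 16 lifted to the union table. -/
theorem rb_A44R_16 : refute Gneg_A44R G_A44R tab_A44R [anchor_A44R, (![2, 3, 0, 1], ![1, 1, 1, 1])] rest_A44R = true :=
  refute_mono Gneg_A44R G_A44R tab_A44R_16 tab_A44R (fun pre h => by unfold tab_A44R; exact certFor_append_left G_A44R _ _ pre (certFor_append_left G_A44R _ _ pre (certFor_append_left G_A44R _ _ pre (certFor_append_left G_A44R _ _ pre (certFor_append_left G_A44R _ _ pre (certFor_append_left G_A44R _ _ pre (certFor_append_left G_A44R _ _ pre (certFor_append_left G_A44R _ _ pre (certFor_append_left G_A44R _ _ pre (certFor_append_left G_A44R _ _ pre (certFor_append_left G_A44R _ _ pre (certFor_append_left G_A44R _ _ pre (certFor_append_left G_A44R _ _ pre (certFor_append_left G_A44R _ _ pre (certFor_append_left G_A44R _ _ pre (certFor_append_left G_A44R _ _ pre (certFor_append G_A44R _ _ pre h))))))))))))))))) _ _ refuted_A44R_16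

/-- branch 17 lifted to the union table. -/
theorem rb_A44R_17 : refute Gneg_A44R G_A44R tab_A44R [anchor_A44R, (![2, 3, 1, 0], ![1, 1, 1, 1])] rest_A44R = true :=
  refute_mono Gneg_A44R G_A44R tab_A44R_17 tab_A44R (fun pre h => by unfold tab_A44R; exact certFor_append_left G_A44R _ _ pre (certFor_append_left G_A44R _ _ pre (certFor_append_left G_A44R _ _ pre (certFor_append_left G_A44R _ _ pre (certFor_append_left G_A44R _ _ pre (certFor_append_left G_A44R _ _ pre (certFor_append_left G_A44R _ _ pre (certFor_append_left G_A44R _ _ pre (certFor_append_left G_A44R _ _ pre (certFor_append_left G_A44R _ _ pre (certFor_append_left G_A44R _ _ pre (certFor_append_left G_A44R _ _ pre (certFor_append_left G_A44R _ _ pre (certFor_append_left G_A44R _ _ pre (certFor_append_left G_A44R _ _ pre (certFor_append_left G_A44R _ _ pre (certFor_append_left G_A44R _ _ pre (certFor_append G_A44R _ _ pre h)))))))))))))))))) _ _ refuted_A44R_17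

/-- branch 18 lifted to the union table. -/
theorem rb_A44R_18 : refute Gneg_A44R G_A44R tab_A44R [anchor_A44R, (![3, 0, 1, 2], ![1, 1, 1, 1])] rest_A44R = true :=
  refute_mono Gneg_A44R G_A44R tab_A44R_18 tab_A44R (fun pre h => by unfold tab_A44R; exact certFor_append_left G_A44R _ _ pre (certFor_append_left G_A44R _ _ pre (certFor_append_left G_A44R _ _ pre (certFor_append_left G_A44R _ _ pre (certFor_append_left G_A44R _ _ pre (certFor_append_left G_A44R _ _ pre (certFor_append_left G_A44R _ _ pre (certFor_append_left G_A44R _ _ pre (certFor_append_left G_A44R _ _ pre (certFor_append_left G_A44R _ _ pre (certFor_append_left G_A44R _ _ pre (certFor_append_left G_A44R _ _ pre (certFor_append_left G_A44R _ _ pre (certFor_append_left G_A44R _ _ pre (certFor_append_left G_A44R _ _ pre (certFor_append_left G_A44R _ _ pre (certFor_append_left G_A44R _ _ pre (certFor_append_left G_A44R _ _ pre (certFor_append G_A44R _ _ pre h))))))))))))))))))) _ _ refuted_A44R_18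

/-- branch 19 lifted to the union table. -/
theorem rb_A44R_19 : refute Gneg_A44R G_A44R tab_A44R [anchor_A44R, (![3, 0, 2, 1], ![1, 1, 1, 1])] rest_A44R = true :=
  refute_mono Gneg_A44R G_A44R tab_A44R_19 tab_A44R (fun pre h => by unfold tab_A44R; exact certFor_append_left G_A44R _ _ pre (certFor_append_left G_A44R _ _ pre (certFor_append_left G_A44R _ _ pre (certFor_append_left G_A44R _ _ pre (certFor_append_left G_A44R _ _ pre (certFor_append_left G_A44R _ _ pre (certFor_append_left G_A44R _ _ pre (certFor_append_left G_A44R _ _ pre (certFor_append_left G_A44R _ _ pre (certFor_append_left G_A44R _ _ pre (certFor_append_left G_A44R _ _ pre (certFor_append_left G_A44R _ _ pre (certFor_append_left G_A44R _ _ pre (certFor_append_left G_A44R _ _ pre (certFor_append_left G_A44R _ _ pre (certFor_append_left G_A44R _ _ pre (certFor_append_left G_A44R _ _ pre (certFor_append_left G_A44R _ _ pre (certFor_append_left G_A44R _ _ pre (certFor_append G_A44R _ _ pre h)))))))))))))))))))) _ _ refuted_A44R_19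

/-- branch 20 lifted to the union table. -/
theorem rb_A44R_20 : refute Gneg_A44R G_A44R tab_A44R [anchor_A44R, (![3, 1, 0, 2], ![1, 1, 1, 1])] rest_A44R = true :=
  refute_mono Gneg_A44R G_A44R tab_A44R_20 tab_A44R (fun pre h => by unfold tab_A44R; exact certFor_append_left G_A44R _ _ pre (certFor_append_left G_A44R _ _ pre (certFor_append_left G_A44R _ _ pre (certFor_append_left G_A44R _ _ pre (certFor_append_left G_A44R _ _ pre (certFor_append_left G_A44R _ _ pre (certFor_append_left G_A44R _ _ pre (certFor_append_left G_A44R _ _ pre (certFor_append_left G_A44R _ _ pre (certFor_append_left G_A44R _ _ pre (certFor_append_left G_A44R _ _ pre (certFor_append_left G_A44R _ _ pre (certFor_append_left G_A44R _ _ pre (certFor_append_left G_A44R _ _ pre (certFor_append_left G_A44R _ _ pre (certFor_append_left G_A44R _ _ pre (certFor_append_left G_A44R _ _ pre (certFor_append_left G_A44R _ _ pre (certFor_append_left G_A44R _ _ pre (certFor_append_left G_A44R _ _ pre (certFor_append G_A44R _ _ pre h))))))))))))))))))))) _ _ refuted_A44R_20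

/-- branch 21 lifted to the union table. -/
theorem rb_A44R_21 : refute Gneg_A44R G_A44R tab_A44R [anchor_A44R, (![3, 1, 2, 0], ![1, 1, 1, 1])] rest_A44R = true :=
  refute_mono Gneg_A44R G_A44R tab_A44R_21 tab_A44R (fun pre h => by unfold tab_A44R; exact certFor_append_left G_A44R _ _ pre (certFor_append_left G_A44R _ _ pre (certFor_append_left G_A44R _ _ pre (certFor_append_left G_A44R _ _ pre (certFor_append_left G_A44R _ _ pre (certFor_append_left G_A44R _ _ pre (certFor_append_left G_A44R _ _ pre (certFor_append_left G_A44R _ _ pre (certFor_append_left G_A44R _ _ pre (certFor_append_left G_A44R _ _ pre (certFor_append_left G_A44R _ _ pre (certFor_append_left G_A44R _ _ pre (certFor_append_left G_A44R _ _ pre (certFor_append_left G_A44R _ _ pre (certFor_append_left G_A44R _ _ pre (certFor_append_left G_A44R _ _ pre (certFor_append_left G_A44R _ _ pre (certFor_append_left G_A44R _ _ pre (certFor_append_left G_A44R _ _ pre (certFor_append_left G_A44R _ _ pre (certFor_append_left G_A44R _ _ pre (certFor_append G_A44R _ _ pre h)))))))))))))))))))))) _ _ refuted_A44R_21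

/-- branch 22 lifted to the union table. -/
theorem rb_A44R_22 : refute Gneg_A44R G_A44R tab_A44R [anchor_A44R, (![3, 2, 0, 1], ![1, 1, 1, 1])] rest_A44R = true :=
  refute_mono Gneg_A44R G_A44R tab_A44R_22 tab_A44R (fun pre h => by unfold tab_A44R; exact certFor_append_left G_A44R _ _ pre (certFor_append_left G_A44R _ _ pre (certFor_append_left G_A44R _ _ pre (certFor_append_left G_A44R _ _ pre (certFor_append_left G_A44R _ _ pre (certFor_append_left G_A44R _ _ pre (certFor_append_left G_A44R _ _ pre (certFor_append_left G_A44R _ _ pre (certFor_append_left G_A44R _ _ pre (certFor_append_left G_A44R _ _ pre (certFor_append_left G_A44R _ _ pre (certFor_append_left G_A44R _ _ pre (certFor_append_left G_A44R _ _ pre (certFor_append_left G_A44R _ _ pre (certFor_append_left G_A44R _ _ pre (certFor_append_left G_A44R _ _ pre (certFor_append_left G_A44R _ _ pre (certFor_append_left G_A44R _ _ pre (certFor_append_left G_A44R _ _ pre (certFor_append_left G_A44R _ _ pre (certFor_append_left G_A44R _ _ pre (certFor_append_left G_A44R _ _ pre (certFor_append G_A44R _ _ pre h)))))))))))))))))))))))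 _ _ refuted_A44R_22

/-- branch 23 lifted to the union table. -/
theorem rb_A44R_23 : refute Gneg_A44R G_A44R tab_A44R [anchor_A44R, (![3, 2, 1, 0], ![1, 1, 1, 1])] rest_A44R = true :=
  refute_mono Gneg_A44R G_A44R tab_A44R_23 tab_A44R (fun pre h => by unfold tab_A44R; exact certFor_append_left G_A44R _ _ pre (certFor_append_left G_A44R _ _ pre (certFor_append_left G_A44R _ _ pre (certFor_append_left G_A44R _ _ pre (certFor_append_left G_A44R _ _ pre (certFor_append_left G_A44R _ _ pre (certFor_append_left G_A44R _ _ pre (certFor_append_left G_A44R _ _ pre (certFor_append_left G_A44R _ _ pre (certFor_append_left G_A44R _ _ pre (certFor_append_left G_A44R _ _ pre (certFor_append_left G_A44R _ _ pre (certFor_append_left G_A44R _ _ pre (certFor_append_left G_A44R _ _ pre (certFor_append_left G_A44R _ _ pre (certFor_append_left G_A44R _ _ pre (certFor_append_left G_A44R _ _ pre (certFor_append_left G_A44R _ _ pre (certFor_append_left G_A44R _ _ pre (certFor_append_left G_A44R _ _ pre (certFor_append_left G_A44R _ _ pre (certFor_append_left G_A44R _ _ pre (certFor_append_left G_A44R _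 _ pre (h)))))))))))))))))))))))) _ _ refuted_A44R_23

/-- **the kernel search for core A44R**, assembled from its 24 branches. -/
theorem refuted_A44R : refute1 Gneg_A44R G_A44R tab_A44R pat_A44R = true := by
  refine refute1_of_refute Gneg_A44R G_A44R tab_A44R ![0, 0, 0, 0] _ _ filter_first_A44R ?_
  refine refute_cons_of_forall Gneg_A44R G_A44R tab_A44R _ _ _ fun t ht => ?_
  rw [cands_second_A44R] at ht
  simp only [branches_A44R, List.mem_cons, List.not_mem_nil, or_false] at ht
  rcases ht with rfl | rfl | rfl | rfl | rfl | rfl | rfl | rfl | rfl | rfl | rfl | rfl | rfl | rfl | rfl | rfl | rfl | rfl | rfl | rfl | rfl | rfl | rfl | rfl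
  · exact Or.inr (Or.inr rb_A44R_0)
  · exact Or.inr (Or.inr rb_A44R_1)
  · exact Or.inr (Or.inr rb_A44R_2)
  · exact Or.inr (Or.inr rb_A44R_3)
  · exact Or.inr (Or.inr rb_A44R_4)
  · exact Or.inr (Or.inr rb_A44R_5)
  · exact Or.inr (Or.inr rb_A44R_6)
  · exact Or.inr (Or.inr rb_A44R_7)
  · exact Or.inr (Or.inr rb_A44R_8)
  · exact Or.inr (Or.inr rb_A44R_9)
  · exact Or.inr (Or.inr rb_A44R_10)
  · exact Or.inr (Or.inr rb_A44R_11)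
  · exact Or.inr (Or.inr rb_A44R_12)
  · exact Or.inr (Or.inr rb_A44R_13)
  · exact Or.inr (Or.inr rb_A44R_14)
  · exact Or.inr (Or.inr rb_A44R_15)
  · exact Or.inr (Or.inr rb_A44R_16)
  · exact Or.inr (Or.inr rb_A44R_17)
  · exact Or.inr (Or.inr rb_A44R_18)
  · exact Or.inr (Or.inr rb_A44R_19)
  · exact Or.inr (Or.inr rb_A44R_20)
  · exact Or.inr (Or.inr rb_A44R_21)
  · exact Or.inr (Or.inr rb_A44R_22)
  · exact Or.inr (Or.inr rb_A44R_23)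

/-- **CORE A44R IS FORBIDDEN ON ITS REGION.** -/
theorem core_A44R (d : Fin 4 → ℕ) (hG1 : d 0 + 2 * d 2 ≤ 3 * d 1) (hG2 : d 0 + 2 * d 3 ≤ 3 * d 2) (hG3 : 2 * d 1 ≤ d 0 + d 3)
    (v ε : Fin 4 → Fin 4 → Fin 4 → ℤ) (fut : List (ℤ × RT)) (hF : List.Forall₂ (fun f h => histA f.2.2 = h) fut pat_A44R)
    (hdom : ∀ a ∈ fut, IsDominant d v ε a.1 a.2) (hpw : fut.Pairwise (fun a b => a.1 < b.1)) : False := by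
  refine not_realised_of_refute1 d v ε Gneg_A44R G_A44R tab_A44R ?_ ?_ ?_ ?_ pat_A44R refuted_A44R fut hF hdom hpw
  · intro g hg
    simp only [Gneg_A44R, List.mem_cons, List.mem_nil_iff, or_false] at hg
    rcases hg with rfl | rfl | rfl | rfl | rfl | rfl | rfl | rfl | rfl <;> simp [form, Fin.sum_univ_four] <;> omega
  · simp [G_A44R, form, Fin.sum_univ_four]; omega
  · simp [G_A44R, form, Fin.sum_univ_four]; omega
  · simp [G_A44R, form, Fin.sum_univ_four]; omega

/-- **THE `(4,4)` ROW IS NOT COUNTING-TIGHT ON THE REGION OF CORE A44R.** -/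
theorem designRowD_four_four_33_A44R (d : Fin 4 → ℕ) (hG1 : d 0 + 2 * d 2 ≤ 3 * d 1) (hG2 : d 0 + 2 * d 3 ≤ 3 * d 2) (hG3 : 2 * d 1 ≤ d 0 + d 3)
    (hS1 : 4 * d 0 < 4 * d 1) (hS2 : 4 * d 1 < 2 * d 0 + 2 * d 3) (hS3 : d 0 + 2 * d 3 < 3 * d 2) (v ε : Fin 4 → Fin 4 → Fin 4 → ℤ) : DesignRowD d v ε 33 := by
  classical
  intro n θ p hθ hdom hne
  by_contra hn
  push Not at hn
  obtain ⟨hsm, hsurj⟩ := ParityLaw.classSym_surjective_of_full d v ε θ p hθ hdom hne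
    (by rw [show Nat.multichoose 4 4 = 35 by rw [Nat.multichoose_eq]; decide]; omega)
  obtain ⟨kA, hkA⟩ := hsurj (classSym ((1 : Equiv.Perm (Fin 4)), ![0, 0, 0, 0]))
  obtain ⟨kB, hkB⟩ := hsurj (classSym ((1 : Equiv.Perm (Fin 4)), ![1, 1, 1, 1]))
  obtain ⟨kC, hkC⟩ := hsurj (classSym ((1 : Equiv.Perm (Fin 4)), ![3, 3, 0, 0]))
  obtain ⟨kD, hkD⟩ := hsurj (classSym ((1 : Equiv.Perm (Fin 4)), ![2, 2, 2, 0]))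
  have eA : histA (p kA).2 = ![4, 0, 0, 0] := by rw [histA4_eq_of_classSym_eq hkA.symm]; decide
  have eB : histA (p kB).2 = ![0, 4, 0, 0] := by rw [histA4_eq_of_classSym_eq hkB.symm]; decide
  have eC : histA (p kC).2 = ![2, 0, 0, 2] := by rw [histA4_eq_of_classSym_eq hkC.symm]; decide
  have eD : histA (p kD).2 = ![1, 0, 3, 0] := by rw [histA4_eq_of_classSym_eq hkD.symm]; decide
  have sA : Summit.ValiantsHypothesis.ValiantsHypothesis.Theorems.LacunarySymmetroidMatrixDescartes.TropicalCensus.slope d (p kA) = 4 * (d 0 : ℤ) := by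
    rw [slope_eq_form, eA]; simp [form, Fin.sum_univ_four]
  have sB : Summit.ValiantsHypothesis.ValiantsHypothesis.Theorems.LacunarySymmetroidMatrixDescartes.TropicalCensus.slope d (p kB) = 4 * (d 1 : ℤ) := by
    rw [slope_eq_form, eB]; simp [form, Fin.sum_univ_four]
  have sC : Summit.ValiantsHypothesis.ValiantsHypothesis.Theorems.LacunarySymmetroidMatrixDescartes.TropicalCensus.slope d (p kC) = 2 * (d 0 : ℤ) + 2 * (d 3 : ℤ) := by
    rw [slope_eq_form, eC]; simp [form, Fin.sum_univ_four]
  have sD : Summit.ValiantsHypothesis.ValiantsHypothesis.Theorems.LacunarySymmetroidMatrixDescartes.TropicalCensus.slope d (p kD) = (d 0 : ℤ) + 3 * (d 2 : ℤ) := by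
    rw [slope_eq_form, eD]; simp [form, Fin.sum_univ_four]
  have hAB : kA < kB := hsm.lt_iff_lt.mp (by
    show Summit.ValiantsHypothesis.ValiantsHypothesis.Theorems.LacunarySymmetroidMatrixDescartes.TropicalCensus.slope d (p kA) < Summit.ValiantsHypothesis.ValiantsHypothesis.Theorems.LacunarySymmetroidMatrixDescartes.TropicalCensus.slope d (p kB); rw [sA, sB]; omega)
  have hBC : kB < kC := hsm.lt_iff_lt.mp (by
    show Summit.ValiantsHypothesis.ValiantsHypothesis.Theorems.LacunarySymmetroidMatrixDescartes.TropicalCensus.slope d (p kB) < Summit.ValiantsHypothesis.ValiantsHypothesis.Theorems.LacunarySymmetroidMatrixDescartes.TropicalCensus.slope d (p kC); rw [sB, sC]; omega)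
  have hCD : kC < kD := hsm.lt_iff_lt.mp (by
    show Summit.ValiantsHypothesis.ValiantsHypothesis.Theorems.LacunarySymmetroidMatrixDescartes.TropicalCensus.slope d (p kC) < Summit.ValiantsHypothesis.ValiantsHypothesis.Theorems.LacunarySymmetroidMatrixDescartes.TropicalCensus.slope d (p kD); rw [sC, sD]; omega)
  refine core_A44R d hG1 hG2 hG3 v ε [(θ kA, p kA), (θ kB, p kB), (θ kC, p kC), (θ kD, p kD)] ?_ ?_ ?_
  · simp only [pat_A44R]
    exact List.Forall₂.cons eA (List.Forall₂.cons eB (List.Forall₂.cons eC (List.Forall₂.cons eD List.Forall₂.nil)))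
  · intro a ha
    simp only [List.mem_cons, List.mem_nil_iff, or_false] at ha
    rcases ha with rfl | rfl | rfl | rfl <;> exact hdom _
  · have h1 := hθ hAB; have h2 := hθ hBC; have h3 := hθ hCD
    simp only [List.pairwise_cons, List.mem_cons, or_false, forall_eq_or_imp, forall_eq, List.Pairwise.nil,
      and_true, List.not_mem_nil, IsEmpty.forall_iff, implies_true]
    refine ⟨⟨h1, by linarith, by linarith⟩, ⟨h2, by linarith⟩, h3⟩

/-- signed form. -/
theorem four_four_le_33_signed_A44R (d : Fin 4 → ℕ) (hG1 : d 0 + 2 * d 2 ≤ 3 * d 1) (hG2 : d 0 + 2 * d 3 ≤ 3 * d 2) (hG3 : 2 * d 1 ≤ d 0 + d 3)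
    (hS1 : 4 * d 0 < 4 * d 1) (hS2 : 4 * d 1 < 2 * d 0 + 2 * d 3) (hS3 : d 0 + 2 * d 3 < 3 * d 2) (v ε : Fin 4 → Fin 4 → Fin 4 → ℤ) (n : ℕ) (θ : Fin (n + 1) → ℤ)
    (p : Fin (n + 1) → RT) (hθ : StrictMono θ) (hdom : ∀ k, IsDominant d v ε (θ k) (p k))
    (halt : ∀ k : Fin n, termSign ε (p k.castSucc) * termSign ε (p k.succ) < 0) : n ≤ 33 := by
  refine designRowD_four_four_33_A44R d hG1 hG2 hG3 hS1 hS2 hS3 v ε n θ p hθ hdom fun k h => ?_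
  have := halt k
  rw [h] at this
  exact absurd this (not_lt.mpr (mul_self_nonneg _))

/-- the instance `(0, 12, 17, 25)`. -/
theorem designRowD_four_four_33_A44R_example (v ε : Fin 4 → Fin 4 → Fin 4 → ℤ) : DesignRowD ![0, 12, 17, 25] v ε 33 :=
  designRowD_four_four_33_A44R _ (by decide) (by decide) (by decide) (by decide) (by decide) (by decide) v ε

end FourFourCore

end Summit.ValiantsHypothesis.ValiantsHypothesis.Theorems.KPlusLogSqLaw
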